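import Literature.NumberTheory.GaloisRepresentations.GaloisH1MapBijectiveUnramified
import Literature.NumberTheory.GaloisRepresentations.LocalHOneInertiaRestrictionProfinite
import Literature.NumberTheory.GaloisRepresentations.ContinuousH1ResCocycle
import Literature.NumberTheory.GaloisRepresentations.LocalGaloisGroupFrobeniusProofs
import Literature.NumberTheory.GaloisRepresentations.AbsGaloisGroupCompact
import Literature.NumberTheory.GaloisRepresentations.GaloisRepUnramifiedProofs
import HarnessLib

/-!
# `H¹(f)(H¹_ur(F, W)) = H¹_ur(F, W')` for an equivariant map SURJECTIVE on inertia invariants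
# (finite discrete coefficients over a non-archimedean local field; theorems only, no definition, no named fact)

Topic `NumberTheory/GaloisRepresentations`; namespace `Literature.NumberTheory.GaloisRepresentations`.
Companion of `GaloisH1MapBijectiveUnramified` (`galoisCohomology.map_unramifiedSubgroup_le`: `H¹(f)` maps
unramified classes to unramified classes, with equality for BIJECTIVE `f`).  Here the equality is proved for
maps that are merely surjective on the `I_F`-invariants — in particular for every SURJECTIVE equivariant map out
of an UNRAMIFIED finite module (inertia acting trivially), the situation of the transition maps
`T/𝔪^{k+1}T ↠ T/𝔪^kT` of an unramified `𝔪`-adic tower at a place `v ∤ p` outside the bad set (Howard 2004, §1.6: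
the Selmer structure on `T^{(k)}` propagated from `T`; Mazur–Rubin, *Kolyvagin systems*, Lemma 1.1.5 / Ex. 1.1.6).

For a non-archimedean local field `F` with inertia group `I_F = absInertia F` (`= Gal(F̄/F^nr)`,
`galUnr_eq_absInertia`) and a discrete `Γ_F`-module `W`, the tree's `DiscreteGaloisModule.unramifiedSubgroup τ 1`
is `ker (H¹(F, W) → H¹(F^nr, W))` (restriction along `Γ_{F^nr} → Γ_F`, whose image is `I_F`):

* §1 **`H¹_ur = classes of I_F-vanishing cocycles`**: `oneCocycleClass_mem_unramifiedSubgroup_of_vanishing`,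
  `exists_vanishing_absInertia_of_mem_unramifiedSubgroup`, `mem_unramifiedSubgroup_one_iff_exists_vanishing`
  (restriction on cocycles `res_oneCocycleClass`, `exists_absGaloisRestrict_eq_of_mem_galUnr`).
* §2 **`galoisCohomology.map_unramifiedSubgroup_eq_of_forall_exists`**: for `W` FINITE and
  `f : W →ⁱL W'` such that every `I_F`-invariant of `W'` lifts to an `I_F`-invariant of `W`,
  `(H¹_ur W).map H¹(f) = H¹_ur W'`.  Proof (Serre, *Local Fields* XIII §1: `H¹(F^nr/F, X) = X/(φ − 1)X`):
  an unramified class of `W'` has an `I_F`-vanishing representative `z'`; its value `z'(φ)` at a Frobenius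
  lift `φ` is `I_F`-invariant, lift it to `t ∈ W^{I_F}`; the tree's
  `exists_vanishing_apply_eq_of_isFreeProcyclic` (+ (KM4) for finite coefficients,
  `exists_contOneCocycles_apply_eq_of_finite`; `Γ_F/I_F ≅ Ẑ` topologically generated by `φ`) gives an
  `I_F`-vanishing cocycle `z` of `W` with `z(φ) = t`, and `f ∘ z`, `z'` are `I_F`-vanishing with the same value
  at `φ`, hence cohomologous (`oneCocycleClass_eq_iff_of_vanishing_absInertia`).
  Corollaries **`galoisCohomology.map_unramifiedSubgroup_eq_of_surjective`** (`f` surjective, `I_F` trivial on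
  `W`) and `galoisCohomology.mem_map_unramifiedSubgroup_iff_of_surjective`.

References: [SerreLocalFields1979] XIII §1 Prop. 1; [Rubin2000] Lemma 1.3.2 (i), Lemma 1.3.5;
[MazurRubin2004] Lemma 1.1.5, Example 1.1.6; [Howard2004HeegnerKolyvagin] §1.1 (Def. 1.1.3), §1.6; [MilneADT2006] I §2.
BSD is not proved by any of this.
-/

noncomputable section

open Function Field IsNonarchimedeanLocalField
open scoped ContRepresentation

namespace Literature.NumberTheory.GaloisRepresentations

open _root_.Subgroup Literature.GroupTheory IsNonarchimedeanLocalField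

variable {F : Type} [Field F] [ValuativeRel F] [TopologicalSpace F] [IsNonarchimedeanLocalField F]
  {W W' : Type} [AddCommGroup W] [TopologicalSpace W] [DiscreteTopology W]
  [AddCommGroup W'] [TopologicalSpace W'] [DiscreteTopology W']
  (τ : DiscreteGaloisModule F W) (τ' : DiscreteGaloisModule F W')

/-! ## §1 Unramified classes are the classes of `I_F`-vanishing cocycles -/

namespace DiscreteGaloisModule

/-- **An `I_F`-vanishing cocycle has unramified class**: its restriction along `Γ_{F^nr} → Γ_F` (which lands
in `I_F = Gal(F̄/F^nr)`, `absGaloisRestrict_mem_galUnr`) is the zero cocycle.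
[cite: SerreGaloisCohomology1997, I §2.6 (b)] [cite: MilneADT2006, Ch. I §2 (unramified cohomology)] -/
theorem oneCocycleClass_mem_unramifiedSubgroup_of_vanishing (z : contOneCocycles τ.toTopRep)
    (hz : ∀ n : absInertia F, z.1 n = 0) : oneCocycleClass τ.toTopRep z ∈ τ.unramifiedSubgroup 1 := by
  refine (DiscreteGaloisModule.mem_unramifiedSubgroup_iff τ 1 _).2 ?_
  rw [galoisCohomology.res_oneCocycleClass]
  refine (oneCocycleClass_eq_zero_iff _ _).2 ⟨0, fun σ ↦ ?_⟩
  rw [map_zero, sub_zero]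
  have hσ := absGaloisRestrict_mem_galUnr F σ
  rw [galUnr_eq_absInertia] at hσ
  exact hz ⟨_, hσ⟩

/-- **An unramified class has an `I_F`-vanishing representative**: if `res_{F^nr} [z₀] = 0` then
`z₀ ∘ (Γ_{F^nr} → Γ_F) = ∂w`, and `z₀ − ∂w` vanishes on the image `I_F` of `Γ_{F^nr} → Γ_F`
(`exists_absGaloisRestrict_eq_of_mem_galUnr`). [cite: SerreGaloisCohomology1997, I §2.6 (b)]
[cite: MilneADT2006, Ch. I §2 (unramified cohomology)] -/
theorem exists_vanishing_absInertia_of_mem_unramifiedSubgroup {c : galoisCohomology τ 1}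
    (hc : c ∈ τ.unramifiedSubgroup 1) :
    ∃ z : contOneCocycles τ.toTopRep, oneCocycleClass τ.toTopRep z = c ∧ ∀ n : absInertia F, z.1 n = 0 := by
  obtain ⟨z₀, rfl⟩ := oneCocycleClass_surjective τ.toTopRep c
  have hc₁ := (DiscreteGaloisModule.mem_unramifiedSubgroup_iff τ 1 _).1 hc
  rw [galoisCohomology.res_oneCocycleClass] at hc₁
  obtain ⟨w, hw⟩ := (oneCocycleClass_eq_zero_iff _ _).1 hc₁
  refine ⟨z₀ - coboundaryCocycle τ w,
    by rw [oneCocycleClass_sub, oneCocycleClass_coboundaryCocycle, sub_zero], fun n ↦ ?_⟩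
  have hn : (n : absoluteGaloisGroup F) ∈ galUnr F := by
    rw [galUnr_eq_absInertia]; exact n.2
  obtain ⟨σ, hσ⟩ := exists_absGaloisRestrict_eq_of_mem_galUnr F hn
  -- `hw σ : z₀ (σ|_{F̄}) = σ|_{F̄} • w - w`, and `σ|_{F̄} = n`
  have h : z₀.1 (absGaloisRestrict F _ σ) = τ (absGaloisRestrict F _ σ) w - w := hw σ
  rw [hσ] at h
  change z₀.1 n - (τ (n : absoluteGaloisGroup F) w - w) = 0
  rw [h, sub_self]

/-- **`H¹_ur(F, W)` = the classes of the `I_F`-vanishing cocycles.** [cite: SerreGaloisCohomology1997, I §2.6 (b)]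
[cite: MilneADT2006, Ch. I §2 (unramified cohomology)] -/
theorem mem_unramifiedSubgroup_one_iff_exists_vanishing (c : galoisCohomology τ 1) :
    c ∈ τ.unramifiedSubgroup 1 ↔
      ∃ z : contOneCocycles τ.toTopRep, oneCocycleClass τ.toTopRep z = c ∧ ∀ n : absInertia F, z.1 n = 0 :=
  ⟨τ.exists_vanishing_absInertia_of_mem_unramifiedSubgroup, fun ⟨z, hzc, hz⟩ ↦
    hzc ▸ τ.oneCocycleClass_mem_unramifiedSubgroup_of_vanishing z hz⟩

/-- The values of an `I_F`-vanishing cocycle are `I_F`-invariant (`I_F ⊴ Γ_F`; tree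
`apply_mem_invariants_of_vanishing`). [cite: SerreGaloisCohomology1997, I §2.6 (b)] -/
theorem apply_eq_self_of_vanishing_absInertia (z : contOneCocycles τ.toTopRep)
    (hz : ∀ n : absInertia F, z.1 n = 0) (g : absoluteGaloisGroup F) {σ : absoluteGaloisGroup F}
    (hσ : σ ∈ absInertia F) : τ σ (z.1 g) = z.1 g := by
  haveI : (absInertia F).Normal := absInertia_normal_holds F
  exact apply_mem_invariants_of_vanishing τ.toTopRep z hz g ⟨σ, hσ⟩

/-- **Every `I_F`-invariant of a FINITE discrete module is the value at a Frobenius lift `φ` of an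
`I_F`-vanishing cocycle** (`H¹_ur(F, W) ↠ W^{I_F}/(φ − 1)W^{I_F}`; `Γ_F/I_F ≅ Ẑ` generated by `φ`, (KM4) for finite
coefficients). [cite: SerreLocalFields1979, XIII §1 Prop. 1] [cite: Rubin2000, Lemma 1.3.2] -/
theorem exists_vanishing_absInertia_apply_eq [Finite W] {φ : absoluteGaloisGroup F} (hφ : IsFrobPow φ 1)
    {t : W} (ht : ∀ σ ∈ absInertia F, τ σ t = t) :
    ∃ z : contOneCocycles τ.toTopRep, (∀ n : absInertia F, z.1 n = 0) ∧ z.1 φ = t := by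
  haveI : (absInertia F).Normal := absInertia_normal_holds F
  haveI := absoluteGaloisGroup_compactSpace F
  exact exists_vanishing_apply_eq_of_isFreeProcyclic τ.toTopRep (absInertia F) (isClosed_absInertia_holds F)
    (isFreeProcyclic_quotient_absInertia' F) φ (dense_zpowers_mk_absInertia_of_isFrobPow F hφ)
    (t := t) (fun n ↦ ht n n.2)
    (exists_contOneCocycles_apply_eq_of_finite τ _ (isClosed_topologicalClosure _)
      (dense_zpowers_mk_topologicalClosure' φ)
      (exists_isOpen_index_topologicalClosure_zpowers (absInertia F) (isClosed_absInertia_holds F)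
        (isFreeProcyclic_quotient_absInertia' F) φ (dense_zpowers_mk_absInertia_of_isFrobPow F hφ)) t)

end DiscreteGaloisModule

/-! ## §2 `H¹(f)` maps `H¹_ur(W)` ONTO `H¹_ur(W')` -/

/-- **`H¹(f)(H¹_ur(F, W)) = H¹_ur(F, W')` when every `I_F`-invariant of `W'` lifts along `f` to an
`I_F`-invariant of `W`** (`W` finite discrete; e.g. `f` surjective with `I_F` acting trivially on `W`, or `f`
bijective).  `⊆` is the tree's `map_unramifiedSubgroup_le`; `⊇`: represent an unramified class of `W'` by an
`I_F`-vanishing cocycle `z'`, lift `z'(φ)` to `t ∈ W^{I_F}`, take an `I_F`-vanishing cocycle `z` of `W` with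
`z(φ) = t` (`exists_vanishing_absInertia_apply_eq`); `f ∘ z` and `z'` vanish on `I_F` and agree at `φ`, so they
are cohomologous (`oneCocycleClass_eq_iff_of_vanishing_absInertia`).
[cite: SerreLocalFields1979, XIII §1 Prop. 1] [cite: Rubin2000, Lemma 1.3.2 (i) and Lemma 1.3.5]
[cite: MazurRubin2004, Lemma 1.1.5 and Example 1.1.6] -/
theorem galoisCohomology.map_unramifiedSubgroup_eq_of_forall_exists [Finite W]
    (f : τ.toContRepresentation →ⁱL τ'.toContRepresentation)
    (hf : ∀ w' : W', (∀ σ ∈ absInertia F, τ' σ w' = w') →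
      ∃ w : W, (∀ σ ∈ absInertia F, τ σ w = w) ∧ f w = w') :
    (τ.unramifiedSubgroup 1).map (galoisCohomology.map f 1) = τ'.unramifiedSubgroup 1 := by
  refine le_antisymm (galoisCohomology.map_unramifiedSubgroup_le f) fun c' hc' ↦ ?_
  obtain ⟨φ, hφ⟩ := exists_isFrobPow_holds F 1
  obtain ⟨z', rfl, hz'⟩ := τ'.exists_vanishing_absInertia_of_mem_unramifiedSubgroup hc'
  obtain ⟨t, ht, hft⟩ :=
    hf (z'.1 φ) fun σ hσ ↦ τ'.apply_eq_self_of_vanishing_absInertia z' hz' φ hσ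
  obtain ⟨z, hz, hzφ⟩ := τ.exists_vanishing_absInertia_apply_eq hφ ht
  refine ⟨oneCocycleClass τ.toTopRep z, τ.oneCocycleClass_mem_unramifiedSubgroup_of_vanishing z hz, ?_⟩
  have hmap : galoisCohomology.map f 1 (oneCocycleClass τ.toTopRep z) =
      oneCocycleClass τ'.toTopRep
        (contOneCocycles.pullback (ContinuousMonoidHom.id (absoluteGaloisGroup F))
          (X := τ.toTopRep) (Y := τ'.toTopRep)
          (TopRep.ofHom ⟨f.toContinuousLinearMap, f.isIntertwining'⟩) z) :=
    map_oneCocycleClass _ _ _ z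
  rw [hmap]
  refine (oneCocycleClass_eq_iff_of_vanishing_absInertia F τ'.toTopRep τ'.continuous_smul hφ _ z'
    (fun n ↦ ?_) hz').mpr ⟨0, fun _ ↦ map_zero _, ?_⟩
  · change f (z.1 n) = 0
    rw [hz n, map_zero]
  · change f (z.1 φ) - z'.1 φ = τ' φ 0 - 0
    rw [hzφ, hft, sub_self, map_zero, sub_zero]

/-- **`H¹(f)(H¹_ur(F, W)) = H¹_ur(F, W')` for `f` SURJECTIVE out of an UNRAMIFIED finite module `W`**
(`I_F` acts trivially on `W`, hence on `W' = f(W)`): the transition maps of an unramified finite-level tower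
map the unramified local condition of level `k + 1` ONTO that of level `k`.
[cite: SerreLocalFields1979, XIII §1 Prop. 1] [cite: MazurRubin2004, Lemma 1.1.5 and Example 1.1.6]
[cite: Howard2004HeegnerKolyvagin, Def. 1.1.3 and §1.6] -/
theorem galoisCohomology.map_unramifiedSubgroup_eq_of_surjective [Finite W]
    (f : τ.toContRepresentation →ⁱL τ'.toContRepresentation) (hf : Surjective f)
    (hI : ∀ σ ∈ absInertia F, ∀ w : W, τ σ w = w) :
    (τ.unramifiedSubgroup 1).map (galoisCohomology.map f 1) = τ'.unramifiedSubgroup 1 :=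
  galoisCohomology.map_unramifiedSubgroup_eq_of_forall_exists τ τ' f fun w' _ ↦
    let ⟨w, hw⟩ := hf w'
    ⟨w, fun σ hσ ↦ hI σ hσ w, hw⟩

/-- Membership form: for `f` surjective out of an unramified finite `W`, a class of `H¹(F, W')` is unramified
iff it is `H¹(f)` of an unramified class of `H¹(F, W)`. [cite: SerreLocalFields1979, XIII §1 Prop. 1]
[cite: MazurRubin2004, Lemma 1.1.5 and Example 1.1.6] -/
theorem galoisCohomology.mem_unramifiedSubgroup_iff_exists_of_surjective [Finite W]
    (f : τ.toContRepresentation →ⁱL τ'.toContRepresentation) (hf : Surjective f)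
    (hI : ∀ σ ∈ absInertia F, ∀ w : W, τ σ w = w) (c' : galoisCohomology τ' 1) :
    c' ∈ τ'.unramifiedSubgroup 1 ↔ ∃ c ∈ τ.unramifiedSubgroup 1, galoisCohomology.map f 1 c = c' := by
  rw [← galoisCohomology.map_unramifiedSubgroup_eq_of_surjective τ τ' f hf hI, AddSubgroup.mem_map]

/-! ## §3 Global to local: an equivariant surjection out of a module unramified at `v` -/

section NumberField

open IsDedekindDomain
open scoped NumberField

/-- **`ρ` unramified at `v` ⇒ the inertia group `I_{K_v}` acts trivially on `ρ|_{Γ_{K_v}}`** (pointwise form of the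
tree's local–global compatibility `GaloisRep.isUnramifiedAt_iff_toLocal_holds`).
[cite: NeukirchANT1999, Ch. II §9 Prop. (9.6)] [cite: SerreAbelianLadic1968, Ch. I §2.1] -/
theorem GaloisRep.toLocal_apply_eq_self_of_isUnramifiedAt {K : Type} [Field K] [NumberField K]
    {A : Type*} [CommRing A] [TopologicalSpace A] {M : Type*} [AddCommGroup M] [Module A M] [TopologicalSpace M]
    (ρ : GaloisRep K A M) {v : HeightOneSpectrum (𝓞 K)} (hur : ρ.IsUnramifiedAt v)
    {σ : absoluteGaloisGroup (v.adicCompletion K)} (hσ : σ ∈ absInertia (v.adicCompletion K)) (x : M) :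
    ρ.toLocal v σ x = x :=
  LinearMap.congr_fun ((GaloisRep.isUnramifiedAt_iff_toLocal_holds v ρ).1 hur σ hσ) x

variable {K : Type} [Field K] [NumberField K]
  {V V' : Type} [AddCommGroup V] [TopologicalSpace V] [DiscreteTopology V]
  [AddCommGroup V'] [TopologicalSpace V'] [DiscreteTopology V']
  (ρ : DiscreteGaloisModule K V) (ρ' : DiscreteGaloisModule K V')

/-- **`H¹(f_v)(H¹_ur(K_v, V)) = H¹_ur(K_v, V')`** for an equivariant SURJECTION `f : V ↠ V'` of discrete `Γ_K`-modules
with `V` finite and unramified at the finite place `v` (`f_v = EllipticCurves.DiscreteGaloisModule.localMap f v`, the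
same function as `f`): the transition maps of an unramified finite-level tower map the unramified condition at `v` of
level `k + 1` ONTO that of level `k`.
[cite: SerreLocalFields1979, XIII §1 Prop. 1] [cite: MazurRubin2004, Lemma 1.1.5 and Example 1.1.6]
[cite: Howard2004HeegnerKolyvagin, Def. 1.1.3 and §1.6] -/
theorem galoisCohomology.map_localMap_unramifiedSubgroup_eq_of_surjective [Finite V]
    (f : ρ.toContRepresentation →ⁱL ρ'.toContRepresentation) (hf : Surjective f)
    {v : HeightOneSpectrum (𝓞 K)} (hur : GaloisRep.IsUnramifiedAt v ρ) :
    (DiscreteGaloisModule.unramifiedSubgroup (GaloisRep.toLocal v ρ) 1 :).map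
        (galoisCohomology.map (EllipticCurves.DiscreteGaloisModule.localMap f (Sum.inr v)) 1) =
      (DiscreteGaloisModule.unramifiedSubgroup (GaloisRep.toLocal v ρ') 1 :) :=
  galoisCohomology.map_unramifiedSubgroup_eq_of_surjective (F := v.adicCompletion K)
    (GaloisRep.toLocal v ρ) (GaloisRep.toLocal v ρ') (EllipticCurves.DiscreteGaloisModule.localMap f (Sum.inr v)) hf
    fun _ hσ x ↦ GaloisRep.toLocal_apply_eq_self_of_isUnramifiedAt ρ hur hσ x

end NumberField

end Literature.NumberTheory.GaloisRepresentations

end
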